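import Literature.Analysis.Complex.LoewnerDefs
import Literature.Analysis.Complex.PickFunctionsProofs

/-!
# Loewner's theorem, Part I — matrix calculus of divided differences

First theorem file of the sorry-free discharge of `Literature.Analysis.Complex.loewner_theorem`,
direction (→) (see `LoewnerDefs` for the overall design and the references). Contents, all
folklore finite-dimensional matrix analysis (Hiai–Petz, *Introduction to Matrix Analysis and
Applications* (2014), §3.3–§4.1; Bhatia, *Matrix Analysis*, Ch. V):

* divided differences of monomials and polynomials (`pdd1`, `pdd2`, `polyDD1`, `polyDD2`) and
  their telescoping identities; the noncommutative expansion
  `(D + sH)^m = ∑_r s^r expandCoeff D H m r`, its entries in an eigenbasis of `D`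
  (`expandCoeff_one_apply`, `expandCoeff_two_apply`: first/second divided differences), and the
  polynomial version `polyCoeff` with the derivative formulas along segments;
* divided differences `dd1`, `dd2` of `C¹`/`C²` functions: mean-value bounds, continuity,
  Lipschitz bounds;
* crude entrywise (`ℓ¹`) matrix bounds (`entrySum`), "Lemma A" comparing `f(X) - f(Y)` with
  divided differences in mixed eigenbases, `cfc` of real diagonal matrices, transport of `cfc`
  under reindexing and unitary conjugation, interpolation on finite spectra;
* elementary closure properties of `IsMatrixMonotoneOn` (restriction, affine changes of variable,
  positive combinations, pointwise limits, `-f(-x)`);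
* `C¹`/`C²` Weierstrass approximation with control of derivatives (`exists_polynomial_C2_near`);
* real quadratic forms `qform` and positivity, spectra versus Löwner-order bounds.

No definitions and no named facts in this file (definitions live in `LoewnerDefs`).
-/

noncomputable section

open Finset Matrix Polynomial

namespace Literature.Analysis.Complex

/-! ### Divided differences of monomials -/

/-- Auxiliary for the proof of Loewner's theorem (`pdd1_zero`: pdd1 zero). [folklore] -/
@[simp] theorem pdd1_zero (x y : ℝ) : pdd1 0 x y = 0 := rfl
/-- Auxiliary for the proof of Loewner's theorem (`pdd1_succ`: pdd1 succ). [folklore] -/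
theorem pdd1_succ (m : ℕ) (x y : ℝ) : pdd1 (m + 1) x y = pdd1 m x y * y + x ^ m := rfl
/-- Auxiliary for the proof of Loewner's theorem (`pdd2_zero`: pdd2 zero). [folklore] -/
@[simp] theorem pdd2_zero (x y z : ℝ) : pdd2 0 x y z = 0 := rfl
/-- Auxiliary for the proof of Loewner's theorem (`pdd2_succ`: pdd2 succ). [folklore] -/
theorem pdd2_succ (m : ℕ) (x y z : ℝ) : pdd2 (m + 1) x y z = pdd2 m x y z * z + pdd1 m x y := rfl

/-- `pdd1 m x y (x - y) = x^m - y^m`. [folklore] -/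
theorem pdd1_mul_sub (m : ℕ) (x y : ℝ) : pdd1 m x y * (x - y) = x ^ m - y ^ m := by
  induction m with
  | zero => simp
  | succ m ih => rw [pdd1_succ, add_mul, mul_right_comm, ih]; ring

/-- On the diagonal `pdd1` is the derivative: `pdd1 m x x = m x^{m-1}`. [folklore] -/
theorem pdd1_self (m : ℕ) (x : ℝ) : pdd1 m x x = m * x ^ (m - 1) := by
  induction m with
  | zero => simp
  | succ m ih =>
    rw [pdd1_succ, ih]
    rcases m with _ | m
    · simp
    · simp only [Nat.add_sub_cancel, Nat.cast_add, Nat.cast_one]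
      ring

/-- `pdd2 m x y z (y - z) = pdd1 m x y - pdd1 m x z`. [folklore] -/
theorem pdd2_mul_sub (m : ℕ) (x y z : ℝ) :
    pdd2 m x y z * (y - z) = pdd1 m x y - pdd1 m x z := by
  induction m with
  | zero => simp
  | succ m ih =>
    rw [pdd2_succ, pdd1_succ, pdd1_succ, add_mul, mul_right_comm, ih]
    ring

/-- `pdd1` is symmetric. [folklore] -/
theorem pdd1_comm (m : ℕ) (x y : ℝ) : pdd1 m x y = pdd1 m y x := by
  induction m with
  | zero => simp
  | succ m ih =>
    -- both sides times (x - y) agree; handle x = y separately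
    by_cases hxy : x = y
    · subst hxy; rfl
    · have h1 := pdd1_mul_sub (m + 1) x y
      have h2 := pdd1_mul_sub (m + 1) y x
      have hne : x - y ≠ 0 := sub_ne_zero.mpr hxy
      have : pdd1 (m + 1) y x * (x - y) = x ^ (m + 1) - y ^ (m + 1) := by linear_combination -h2
      exact mul_right_cancel₀ hne (h1.trans this.symm)

/-! ### Divided differences of a polynomial -/

/-- `polyDD1 p x y (x - y) = p(x) - p(y)`. [folklore] -/
theorem polyDD1_mul_sub (p : ℝ[X]) (x y : ℝ) :
    polyDD1 p x y * (x - y) = p.eval x - p.eval y := by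
  simp only [polyDD1, Polynomial.sum, Finset.sum_mul, mul_assoc, pdd1_mul_sub]
  simp only [mul_sub, Finset.sum_sub_distrib, Polynomial.eval_eq_sum, Polynomial.sum]

/-- `polyDD1 p x x = p'(x)`. [folklore] -/
theorem polyDD1_self (p : ℝ[X]) (x : ℝ) : polyDD1 p x x = p.derivative.eval x := by
  simp only [polyDD1, Polynomial.sum, pdd1_self, Polynomial.derivative_eval]
  exact Finset.sum_congr rfl fun _ _ => by ring

/-- `polyDD2 p x y z (y - z) = polyDD1 p x y - polyDD1 p x z`. [folklore] -/
theorem polyDD2_mul_sub (p : ℝ[X]) (x y z : ℝ) :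
    polyDD2 p x y z * (y - z) = polyDD1 p x y - polyDD1 p x z := by
  simp only [polyDD2, polyDD1, Polynomial.sum, Finset.sum_mul, mul_assoc, pdd2_mul_sub]
  simp only [mul_sub, Finset.sum_sub_distrib]

end Literature.Analysis.Complex

namespace Literature.Analysis.Complex

/-! ### The noncommutative expansion of `(D + s H)^m` -/

section Expansion

variable {ι : Type*} [Fintype ι] [DecidableEq ι]

variable (D H : Matrix ι ι ℂ)

/-- Auxiliary for the proof of Loewner's theorem
(`expandCoeff_succ_zero`: expandCoeff succ zero). [folklore] -/
@[simp] theorem expandCoeff_zero_zero : expandCoeff D H 0 0 = 1 := rfl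
/-- Auxiliary for the proof of Loewner's theorem
(`expandCoeff_zero_succ`: expandCoeff zero succ). [folklore] -/
@[simp] theorem expandCoeff_zero_succ (r : ℕ) : expandCoeff D H 0 (r + 1) = 0 := rfl
/-- Auxiliary for the proof of Loewner's theorem
(`expandCoeff_succ_zero`: expandCoeff succ zero). [folklore] -/
theorem expandCoeff_succ_zero (m : ℕ) : expandCoeff D H (m + 1) 0 = expandCoeff D H m 0 * D := rfl
/-- Auxiliary for the proof of Loewner's theorem
(`expandCoeff_succ_succ`: expandCoeff succ succ). [folklore] -/
theorem expandCoeff_succ_succ (m r : ℕ) :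
    expandCoeff D H (m + 1) (r + 1) = expandCoeff D H m (r + 1) * D + expandCoeff D H m r * H := rfl

/-- `expandCoeff D H m r = 0` for `r > m`. [folklore] -/
theorem expandCoeff_eq_zero {m r : ℕ} (h : m < r) : expandCoeff D H m r = 0 := by
  induction m generalizing r with
  | zero =>
    obtain ⟨r, rfl⟩ := Nat.exists_eq_add_of_lt h
    simp
  | succ m ih =>
    obtain ⟨r', rfl⟩ := Nat.exists_eq_add_of_lt h
    rw [show m + 1 + r' + 1 = (m + r' + 1) + 1 by ring, expandCoeff_succ_succ, ih (by omega),
      ih (by omega)]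
    simp

/-- `expandCoeff D H m 0 = D^m`. [folklore] -/
theorem expandCoeff_zero_right (m : ℕ) : expandCoeff D H m 0 = D ^ m := by
  induction m with
  | zero => simp
  | succ m ih => rw [expandCoeff_succ_zero, ih, pow_succ]

/-- **The expansion** `(D + s H)^m = ∑_{r ≤ m} s^r • expandCoeff D H m r`. [folklore] -/
theorem add_smul_pow_eq_sum (s : ℝ) (m : ℕ) :
    (D + (s : ℂ) • H) ^ m = ∑ r ∈ range (m + 1), ((s : ℂ) ^ r) • expandCoeff D H m r := by
  induction m with
  | zero => simp
  | succ m ih =>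
    rw [pow_succ, ih, Finset.sum_mul]
    -- expand each term
    have hterm : ∀ r, ((s : ℂ) ^ r • expandCoeff D H m r) * (D + (s : ℂ) • H) =
        (s : ℂ) ^ r • (expandCoeff D H m r * D) + (s : ℂ) ^ (r + 1) • (expandCoeff D H m r * H) := by
      intro r
      rw [mul_add, smul_mul_assoc, Matrix.mul_smul, smul_mul_assoc, smul_smul, pow_succ, mul_comm]
    simp only [hterm, Finset.sum_add_distrib]
    -- right-hand side: split off r = 0 and shift
    rw [Finset.sum_range_succ' (fun r => (s : ℂ) ^ r • expandCoeff D H (m + 1) r)]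
    simp only [pow_zero, one_smul, expandCoeff_succ_zero, expandCoeff_succ_succ, smul_add,
      Finset.sum_add_distrib]
    -- ∑_{r<m+1} s^r C m r D = C m 0 D + ∑_{r<m} s^(r+1) C m (r+1) D, and the r = m term of the
    -- shifted sum vanishes
    rw [Finset.sum_range_succ' (fun r => (s : ℂ) ^ r • (expandCoeff D H m r * D))]
    rw [Finset.sum_range_succ (fun r => (s : ℂ) ^ (r + 1) • (expandCoeff D H m (r + 1) * D)),
      expandCoeff_eq_zero D H (Nat.lt_succ_self m)]
    simp only [pow_zero, one_smul, Matrix.zero_mul, smul_zero, add_zero]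
    abel

/-- For diagonal `D`, the first-order coefficient is the Hadamard product of `H` with the matrix
of divided differences: `(expandCoeff D H m 1) a b = pdd1 m t_a t_b · H a b`. [folklore] -/
theorem expandCoeff_one_apply (t : ι → ℝ) (m : ℕ) (a b : ι) :
    expandCoeff (diagonal fun i => ((t i : ℝ) : ℂ)) H m 1 a b = (pdd1 m (t a) (t b) : ℂ) * H a b := by
  induction m with
  | zero => simp [expandCoeff_eq_zero]
  | succ m ih =>
    rw [expandCoeff_succ_succ, Matrix.add_apply, Matrix.mul_diagonal, ih, expandCoeff_zero_right,
      diagonal_pow, Pi.pow_def, Matrix.diagonal_mul, pdd1_succ]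
    push_cast
    ring

/-- For diagonal `D`, the second-order coefficient:
`(expandCoeff D H m 2) a b = ∑_c pdd2 m t_a t_c t_b · H a c · H c b`. [folklore] -/
theorem expandCoeff_two_apply (t : ι → ℝ) (m : ℕ) (a b : ι) :
    expandCoeff (diagonal fun i => ((t i : ℝ) : ℂ)) H m 2 a b =
      ∑ c, (pdd2 m (t a) (t c) (t b) : ℂ) * H a c * H c b := by
  induction m with
  | zero => simp [expandCoeff_eq_zero]
  | succ m ih =>
    rw [expandCoeff_succ_succ, Matrix.add_apply, Matrix.mul_diagonal, ih, Matrix.mul_apply]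
    simp only [expandCoeff_one_apply, pdd2_succ, Finset.sum_mul, ← Finset.sum_add_distrib]
    push_cast
    exact Finset.sum_congr rfl fun c _ => by ring

end Expansion

end Literature.Analysis.Complex

namespace Literature.Analysis.Complex

open Set Filter Topology

/-! ### Divided differences of `C¹`/`C²` functions -/

/-- Auxiliary for the proof of Loewner's theorem (`dd1_self`: dd1 self). [folklore] -/
theorem dd1_self (f : ℝ → ℝ) (x : ℝ) : dd1 f x x = deriv f x := by simp [dd1]

/-- Auxiliary for the proof of Loewner's theorem (`dd1_of_ne`: dd1 of ne). [folklore] -/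
theorem dd1_of_ne (f : ℝ → ℝ) {x y : ℝ} (h : x ≠ y) : dd1 f x y = (f x - f y) / (x - y) := by
  simp [dd1, h]

/-- The defining identity `dd1 f x y · (x - y) = f x - f y` (all `x, y`). [folklore] -/
theorem dd1_mul_sub (f : ℝ → ℝ) (x y : ℝ) : dd1 f x y * (x - y) = f x - f y := by
  by_cases h : x = y
  · subst h; simp
  · rw [dd1_of_ne f h, div_mul_cancel₀ _ (sub_ne_zero.mpr h)]

/-- Auxiliary for the proof of Loewner's theorem (`dd1_comm`: dd1 comm). [folklore] -/
theorem dd1_comm (f : ℝ → ℝ) (x y : ℝ) : dd1 f x y = dd1 f y x := by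
  by_cases h : x = y
  · subst h; rfl
  · rw [dd1_of_ne f h, dd1_of_ne f (Ne.symm h), ← neg_sub (f y), ← neg_sub y, neg_div_neg_eq]

/-- `dd2 f x y z · (x - y) = dd1 f x z - dd1 f y z`. [folklore] -/
theorem dd2_mul_sub (f : ℝ → ℝ) (x y z : ℝ) : dd2 f x y z * (x - y) = dd1 f x z - dd1 f y z := by
  by_cases h : x = y
  · subst h; simp [dd2]
  · rw [dd2, if_neg h, div_mul_cancel₀ _ (sub_ne_zero.mpr h)]

/-- **Mean value bound** `|dd1 f x y| ≤ sup |f'|` on an interval. [folklore] -/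
theorem abs_dd1_le {f : ℝ → ℝ} {c d M : ℝ} (hf : ∀ t ∈ Icc c d, DifferentiableAt ℝ f t)
    (hM : ∀ t ∈ Icc c d, |deriv f t| ≤ M) {x y : ℝ} (hx : x ∈ Icc c d) (hy : y ∈ Icc c d) :
    |dd1 f x y| ≤ M := by
  -- reduce to `x < y`
  wlog hxy : x ≤ y generalizing x y
  · rw [dd1_comm]; exact this hy hx (le_of_not_ge hxy)
  rcases hxy.eq_or_lt with rfl | hlt
  · rw [dd1_self]; exact hM x hx
  have hsub : Icc x y ⊆ Icc c d := Icc_subset_Icc hx.1 hy.2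
  have hcont : ContinuousOn f (Icc x y) := fun t ht =>
    (hf t (hsub ht)).continuousAt.continuousWithinAt
  have hdiff : DifferentiableOn ℝ f (Ioo x y) := fun t ht =>
    (hf t (hsub (Ioo_subset_Icc_self ht))).differentiableWithinAt
  obtain ⟨ξ, hξ, hξ'⟩ := exists_deriv_eq_slope f hlt hcont hdiff
  rw [dd1_of_ne f hlt.ne, show (f x - f y) / (x - y) = (f y - f x) / (y - x) by
    rw [← neg_sub (f y), ← neg_sub y, neg_div_neg_eq], ← hξ']
  exact hM ξ (hsub (Ioo_subset_Icc_self hξ))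

section SecondOrder

variable {f f' : ℝ → ℝ} {c d M : ℝ}

/-- Derivative of `t ↦ dd1 f t z` off the base point. [folklore] -/
theorem hasDerivAt_dd1 (hf : ∀ t ∈ Icc c d, HasDerivAt f (f' t) t) {z t : ℝ}
    (ht : t ∈ Icc c d) (htz : t ≠ z) :
    HasDerivAt (fun u => dd1 f u z) ((f' t * (t - z) - (f t - f z)) / (t - z) ^ 2) t := by
  have hev : (fun u => dd1 f u z) =ᶠ[𝓝 t] fun u => (f u - f z) / (u - z) := by
    filter_upwards [eventually_ne_nhds htz] with u hu
    exact dd1_of_ne f hu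
  have h1 : HasDerivAt (fun u => f u - f z) (f' t) t := (hf t ht).sub_const _
  have h2 : HasDerivAt (fun u => u - z) 1 t := (hasDerivAt_id t).sub_const _
  have h3 : HasDerivAt (fun u => (f u - f z) / (u - z))
      ((f' t * (t - z) - (f t - f z) * 1) / (t - z) ^ 2) t := h1.div h2 (sub_ne_zero.mpr htz)
  rw [mul_one] at h3
  exact h3.congr_of_eventuallyEq hev

/-- Bound `|d/dt dd1 f t z| ≤ sup |f''|` off the base point (`f'` is `M`-Lipschitz by the mean
value theorem; crude constant `1`). [folklore] -/
theorem abs_deriv_dd1_le (hf : ∀ t ∈ Icc c d, HasDerivAt f (f' t) t)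
    (hf' : ∀ t ∈ Icc c d, DifferentiableAt ℝ f' t) (hM : ∀ t ∈ Icc c d, |deriv f' t| ≤ M)
    {z t : ℝ} (hz : z ∈ Icc c d) (ht : t ∈ Icc c d) (htz : t ≠ z) :
    |(f' t * (t - z) - (f t - f z)) / (t - z) ^ 2| ≤ M := by
  -- `f t - f z = f' ξ (t - z)` for some `ξ` between `t` and `z`
  have hMVT : ∃ ξ ∈ Icc c d, |ξ - t| ≤ |z - t| ∧ f t - f z = f' ξ * (t - z) := by
    rcases lt_or_gt_of_ne htz with hlt | hgt
    · have hsub : Icc t z ⊆ Icc c d := Icc_subset_Icc ht.1 hz.2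
      obtain ⟨ξ, hξ, hξ'⟩ := exists_hasDerivAt_eq_slope f f' hlt
        (fun u hu => (hf u (hsub hu)).continuousAt.continuousWithinAt)
        (fun u hu => hf u (hsub (Ioo_subset_Icc_self hu)))
      refine ⟨ξ, hsub (Ioo_subset_Icc_self hξ), ?_, ?_⟩
      · rw [abs_of_nonneg (by linarith [hξ.1]), abs_of_nonneg (by linarith)]; linarith [hξ.2]
      · rw [hξ']; field_simp
        ring
    · have hsub : Icc z t ⊆ Icc c d := Icc_subset_Icc hz.1 ht.2
      obtain ⟨ξ, hξ, hξ'⟩ := exists_hasDerivAt_eq_slope f f' hgt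
        (fun u hu => (hf u (hsub hu)).continuousAt.continuousWithinAt)
        (fun u hu => hf u (hsub (Ioo_subset_Icc_self hu)))
      refine ⟨ξ, hsub (Ioo_subset_Icc_self hξ), ?_, ?_⟩
      · rw [abs_of_nonpos (by linarith [hξ.2]), abs_of_nonpos (by linarith)]; linarith [hξ.1]
      · rw [hξ']; field_simp
  obtain ⟨ξ, hξ, hξt, hfeq⟩ := hMVT
  have hlip : |f' t - f' ξ| ≤ M * |t - ξ| := by
    have := (convex_Icc c d).norm_image_sub_le_of_norm_deriv_le hf' (fun u hu => by
      simpa [Real.norm_eq_abs] using hM u hu) hξ ht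
    simpa [Real.norm_eq_abs] using this
  have hnum : f' t * (t - z) - (f t - f z) = (f' t - f' ξ) * (t - z) := by rw [hfeq]; ring
  have htz' : t - z ≠ 0 := sub_ne_zero.mpr htz
  rw [hnum, pow_two, mul_div_mul_right _ _ htz', abs_div]
  rw [div_le_iff₀ (abs_pos.mpr htz')]
  have h1 : |t - ξ| ≤ |t - z| := by rw [abs_sub_comm t ξ, abs_sub_comm t z]; exact hξt
  have hM0 : 0 ≤ M := le_trans (abs_nonneg _) (hM t ht)
  calc |f' t - f' ξ| ≤ M * |t - ξ| := hlip
    _ ≤ M * |t - z| := by gcongr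

/-- Continuity of `t ↦ dd1 f t z` (at the base point the slope tends to the derivative).
[folklore] -/
theorem continuousAt_dd1 (hf : ∀ t ∈ Icc c d, HasDerivAt f (f' t) t) {z t : ℝ}
    (hz : z ∈ Icc c d) (ht : t ∈ Icc c d) : ContinuousAt (fun u => dd1 f u z) t := by
  by_cases htz : t = z
  · subst htz
    rw [← continuousWithinAt_compl_self]
    have h1 : Tendsto (slope f t) (𝓝[≠] t) (𝓝 (f' t)) := (hf t ht).tendsto_slope
    have h2 : dd1 f t t = f' t := by rw [dd1_self, (hf t ht).deriv]
    have h3 : Tendsto (fun u => dd1 f u t) (𝓝[≠] t) (𝓝 (dd1 f t t)) := by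
      rw [h2]
      refine h1.congr' ?_
      filter_upwards [self_mem_nhdsWithin] with u hu
      rw [slope_def_field, dd1_of_ne f hu, ← neg_sub (f t), ← neg_sub t, neg_div_neg_eq]
    exact h3
  · exact (hasDerivAt_dd1 hf ht htz).continuousAt

/-- Lipschitz bound for `t ↦ dd1 f t z` on `[c, d]` with constant `sup |f''|` (split at the base
point; mean value inequality on each side). [folklore] -/
theorem abs_dd1_sub_dd1_le (hf : ∀ t ∈ Icc c d, HasDerivAt f (f' t) t)
    (hf' : ∀ t ∈ Icc c d, DifferentiableAt ℝ f' t) (hM : ∀ t ∈ Icc c d, |deriv f' t| ≤ M)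
    {z : ℝ} (hz : z ∈ Icc c d) {u v : ℝ} (hu : u ∈ Icc c d) (hv : v ∈ Icc c d) :
    |dd1 f u z - dd1 f v z| ≤ M * |u - v| := by
  -- one-sided estimate on an interval not containing `z` in its interior
  have key : ∀ a b : ℝ, a ∈ Icc c d → b ∈ Icc c d → a ≤ b → z ∉ Ioo a b →
      |dd1 f b z - dd1 f a z| ≤ M * (b - a) := by
    intro a b ha hb hab hzab
    have hsub : Icc a b ⊆ Icc c d := Icc_subset_Icc ha.1 hb.2
    have hcont : ContinuousOn (fun t => dd1 f t z) (Icc a b) := fun t ht =>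
      (continuousAt_dd1 hf hz (hsub ht)).continuousWithinAt
    have hder : ∀ t ∈ Ioo a b,
        HasDerivAt (fun t => dd1 f t z) ((f' t * (t - z) - (f t - f z)) / (t - z) ^ 2) t :=
      fun t ht => hasDerivAt_dd1 hf (hsub (Ioo_subset_Icc_self ht)) fun h => hzab (h ▸ ht)
    have hdiff : DifferentiableOn ℝ (fun t => dd1 f t z) (interior (Icc a b)) := by
      rw [interior_Icc]; exact fun t ht => (hder t ht).differentiableAt.differentiableWithinAt
    have hle : ∀ t ∈ interior (Icc a b), deriv (fun t => dd1 f t z) t ≤ M := by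
      rw [interior_Icc]; intro t ht
      rw [(hder t ht).deriv]
      exact (abs_le.mp (abs_deriv_dd1_le hf hf' hM hz (hsub (Ioo_subset_Icc_self ht))
        fun h => hzab (h ▸ ht))).2
    have hge : ∀ t ∈ interior (Icc a b), -M ≤ deriv (fun t => dd1 f t z) t := by
      rw [interior_Icc]; intro t ht
      rw [(hder t ht).deriv]
      exact (abs_le.mp (abs_deriv_dd1_le hf hf' hM hz (hsub (Ioo_subset_Icc_self ht))
        fun h => hzab (h ▸ ht))).1
    have h1 := (convex_Icc a b).image_sub_le_mul_sub_of_deriv_le hcont hdiff hle a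
      (left_mem_Icc.mpr hab) b (right_mem_Icc.mpr hab) hab
    have h2 := (convex_Icc a b).mul_sub_le_image_sub_of_le_deriv hcont hdiff hge a
      (left_mem_Icc.mpr hab) b (right_mem_Icc.mpr hab) hab
    rw [abs_le]; constructor <;> linarith
  -- reduce to `u ≤ v`
  wlog huv : u ≤ v generalizing u v
  · rw [abs_sub_comm, abs_sub_comm u v]; exact this hv hu (le_of_not_ge huv)
  rw [abs_sub_comm (dd1 f u z), abs_sub_comm u v, abs_of_nonneg (sub_nonneg.mpr huv)]
  by_cases hzuv : z ∈ Ioo u v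
  · -- split at `z`
    have e1 := key u z hu hz hzuv.1.le fun h => (lt_irrefl z h.2)
    have e2 := key z v hz hv hzuv.2.le fun h => (lt_irrefl z h.1)
    calc |dd1 f v z - dd1 f u z|
        = |(dd1 f v z - dd1 f z z) + (dd1 f z z - dd1 f u z)| := by ring_nf
      _ ≤ |dd1 f v z - dd1 f z z| + |dd1 f z z - dd1 f u z| := abs_add_le _ _
      _ ≤ M * (v - z) + M * (z - u) := add_le_add e2 e1
      _ = M * (v - u) := by ring
  · exact key u v hu hv huv hzuv

/-- **Second-order bound** `|dd2 f x y z| ≤ sup |f''|` (crude constant `1`). [folklore] -/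
theorem abs_dd2_le (hf : ∀ t ∈ Icc c d, HasDerivAt f (f' t) t)
    (hf' : ∀ t ∈ Icc c d, DifferentiableAt ℝ f' t) (hM : ∀ t ∈ Icc c d, |deriv f' t| ≤ M)
    {x y z : ℝ} (hx : x ∈ Icc c d) (hy : y ∈ Icc c d) (hz : z ∈ Icc c d) :
    |dd2 f x y z| ≤ M := by
  have hM0 : 0 ≤ M := le_trans (abs_nonneg _) (hM x hx)
  by_cases hxy : x = y
  · subst hxy; simpa [dd2] using hM0
  · rw [dd2, if_neg hxy, abs_div, div_le_iff₀ (abs_pos.mpr (sub_ne_zero.mpr hxy))]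
    exact abs_dd1_sub_dd1_le hf hf' hM hz hx hy

end SecondOrder

end Literature.Analysis.Complex

namespace Literature.Analysis.Complex

open scoped ComplexOrder MatrixOrder Matrix.Norms.L2Operator
open Set Filter Topology

section MatrixTools

variable {ι : Type*} [Fintype ι]

/-! ### Entrywise `ℓ¹` size of a matrix and crude bounds -/

/-- Auxiliary for the proof of Loewner's theorem (`entrySum_nonneg`: entrySum nonneg). [folklore] -/
theorem entrySum_nonneg (M : Matrix ι ι ℂ) : 0 ≤ entrySum M :=
  Finset.sum_nonneg fun _ _ => Finset.sum_nonneg fun _ _ => norm_nonneg _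

/-- Auxiliary for the proof of Loewner's theorem
(`norm_entry_le_entrySum`: norm entry le entrySum). [folklore] -/
theorem norm_entry_le_entrySum (M : Matrix ι ι ℂ) (a b : ι) : ‖M a b‖ ≤ entrySum M := by
  calc ‖M a b‖ ≤ ∑ b', ‖M a b'‖ :=
        Finset.single_le_sum (f := fun b' => ‖M a b'‖) (fun _ _ => norm_nonneg _) (Finset.mem_univ b)
    _ ≤ ∑ a', ∑ b', ‖M a' b'‖ :=
        Finset.single_le_sum (f := fun a' => ∑ b', ‖M a' b'‖)
          (fun _ _ => Finset.sum_nonneg fun _ _ => norm_nonneg _) (Finset.mem_univ a)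

/-- Auxiliary for the proof of Loewner's theorem (`entrySum_add_le`: entrySum add le). [folklore] -/
theorem entrySum_add_le (M N : Matrix ι ι ℂ) : entrySum (M + N) ≤ entrySum M + entrySum N := by
  simp only [entrySum, Matrix.add_apply, ← Finset.sum_add_distrib]
  exact Finset.sum_le_sum fun a _ => Finset.sum_le_sum fun b _ => norm_add_le _ _

/-- Auxiliary for the proof of Loewner's theorem (`entrySum_smul`: entrySum smul). [folklore] -/
theorem entrySum_smul (c : ℂ) (M : Matrix ι ι ℂ) : entrySum (c • M) = ‖c‖ * entrySum M := by
  simp only [entrySum, Matrix.smul_apply, smul_eq_mul, norm_mul, Finset.mul_sum]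

/-- Auxiliary for the proof of Loewner's theorem (`entrySum_neg`: entrySum neg). [folklore] -/
theorem entrySum_neg (M : Matrix ι ι ℂ) : entrySum (-M) = entrySum M := by
  simp [entrySum]

/-- Auxiliary for the proof of Loewner's theorem
(`entrySum_sub_comm`: entrySum sub comm). [folklore] -/
theorem entrySum_sub_comm (M N : Matrix ι ι ℂ) : entrySum (M - N) = entrySum (N - M) := by
  rw [← neg_sub, entrySum_neg]

/-- Conjugating by matrices with entries of norm `≤ 1` (e.g. unitaries) multiplies the entrywise
size by at most `n²`. [folklore] -/
theorem entrySum_mul_mul_le {U V : Matrix ι ι ℂ} (hU : ∀ i j, ‖U i j‖ ≤ 1) (hV : ∀ i j, ‖V i j‖ ≤ 1)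
    (N : Matrix ι ι ℂ) :
    entrySum (U * N * V) ≤ (Fintype.card ι : ℝ) ^ 2 * entrySum N := by
  have hentry : ∀ i k, ‖(U * N * V) i k‖ ≤ entrySum N := by
    intro i k
    rw [Matrix.mul_apply]
    refine (norm_sum_le _ _).trans ?_
    unfold entrySum
    rw [Finset.sum_comm]
    refine Finset.sum_le_sum fun b _ => ?_
    rw [Matrix.mul_apply, Finset.sum_mul]
    refine (norm_sum_le _ _).trans (Finset.sum_le_sum fun a _ => ?_)
    rw [norm_mul, norm_mul]
    calc ‖U i a‖ * ‖N a b‖ * ‖V b k‖ ≤ 1 * ‖N a b‖ * 1 := by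
          gcongr
          · exact hU i a
          · exact hV b k
      _ = ‖N a b‖ := by ring
  calc entrySum (U * N * V) = ∑ i, ∑ k, ‖(U * N * V) i k‖ := rfl
    _ ≤ ∑ _i : ι, ∑ _k : ι, entrySum N :=
        Finset.sum_le_sum fun i _ => Finset.sum_le_sum fun k _ => hentry i k
    _ = (Fintype.card ι : ℝ) ^ 2 * entrySum N := by
        simp only [Finset.sum_const, Finset.card_univ, nsmul_eq_mul]; ring

/-- Hadamard product with a matrix of entries bounded by `M`. [folklore] -/
theorem entrySum_hadamard_le {L : Matrix ι ι ℂ} {M : ℝ} (hL : ∀ i k, ‖L i k‖ ≤ M)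
    (W : Matrix ι ι ℂ) : entrySum (L ⊙ W) ≤ M * entrySum W := by
  unfold entrySum
  rw [Finset.mul_sum]
  refine Finset.sum_le_sum fun i _ => ?_
  rw [Finset.mul_sum]
  refine Finset.sum_le_sum fun k _ => ?_
  rw [Matrix.hadamard_apply, norm_mul]
  exact mul_le_mul_of_nonneg_right (hL i k) (norm_nonneg _)

/-- A Hermitian matrix of small entrywise size is almost positive semidefinite:
`re ⟨w, E w⟩ ≥ -entrySum E · ‖w‖²`, with `‖w‖² = ∑ |w_a|²`. [folklore] -/
theorem re_star_dotProduct_mulVec_ge (E : Matrix ι ι ℂ) (w : ι → ℂ) :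
    -(entrySum E * ∑ a, ‖w a‖ ^ 2) ≤ (star w ⬝ᵥ (E *ᵥ w)).re := by
  -- |⟨w, E w⟩| ≤ ∑_{ab} |E_ab| |w_a| |w_b| ≤ entrySum E · max|w|² ≤ entrySum E · ∑ |w_a|²
  have hbound : ‖star w ⬝ᵥ (E *ᵥ w)‖ ≤ entrySum E * ∑ a, ‖w a‖ ^ 2 := by
    have hw : ∀ a, ‖w a‖ ^ 2 ≤ ∑ c, ‖w c‖ ^ 2 := fun a =>
      Finset.single_le_sum (f := fun c => ‖w c‖ ^ 2) (fun _ _ => by positivity) (Finset.mem_univ a)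
    have hterm : ∀ a b, ‖star (w a) * (E a b * w b)‖ ≤ ‖E a b‖ * ∑ c, ‖w c‖ ^ 2 := by
      intro a b
      rw [norm_mul, norm_mul, norm_star]
      have h2 : ‖w a‖ * ‖w b‖ ≤ ∑ c, ‖w c‖ ^ 2 := by
        nlinarith [hw a, hw b, sq_nonneg (‖w a‖ - ‖w b‖), norm_nonneg (w a), norm_nonneg (w b),
          Finset.sum_nonneg (fun c (_ : c ∈ Finset.univ) => sq_nonneg ‖w c‖)]
      calc ‖w a‖ * (‖E a b‖ * ‖w b‖) = ‖E a b‖ * (‖w a‖ * ‖w b‖) := by ring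
        _ ≤ ‖E a b‖ * ∑ c, ‖w c‖ ^ 2 := by gcongr
    calc ‖star w ⬝ᵥ (E *ᵥ w)‖ = ‖∑ a, ∑ b, star (w a) * (E a b * w b)‖ := by
          simp only [dotProduct, Matrix.mulVec, Pi.star_apply, Finset.mul_sum]
      _ ≤ ∑ a, ∑ b, ‖star (w a) * (E a b * w b)‖ :=
          (norm_sum_le _ _).trans (Finset.sum_le_sum fun a _ => norm_sum_le _ _)
      _ ≤ ∑ a, ∑ b, ‖E a b‖ * ∑ c, ‖w c‖ ^ 2 :=
          Finset.sum_le_sum fun a _ => Finset.sum_le_sum fun b _ => hterm a b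
      _ = entrySum E * ∑ c, ‖w c‖ ^ 2 := by
          rw [entrySum, Finset.sum_mul]
          exact Finset.sum_congr rfl fun a _ => by rw [Finset.sum_mul]
  have := (Complex.abs_re_le_norm (star w ⬝ᵥ (E *ᵥ w))).trans hbound
  exact (abs_le.mp this).1

/-! ### Lemma A: differences of matrix functions in mixed eigenbases -/

variable [DecidableEq ι]

/-- **Rosenblum–Rovnyak's Lemma A** (Ch. 2 Addenda no. 3), matrix form: for Hermitian
`X = U diag(x) U⋆`, `Y = V diag(y) V⋆` and any slope function `L` of `f`
(`L a b (a - b) = f a - f b`),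
`U⋆ (f(X) - f(Y)) V = (L(xᵢ, y_k))_{ik} ⊙ (U⋆ (X - Y) V)`.
[cite: RosenblumRovnyak1985, Ch. 2 Examples and Addenda no. 3 Lemma A] -/
theorem lemmaA {X Y : Matrix ι ι ℂ} (hX : X.IsHermitian) (hY : Y.IsHermitian) (f : ℝ → ℝ)
    {L : ℝ → ℝ → ℝ} (hL : ∀ a b, L a b * (a - b) = f a - f b) :
    star (hX.eigenvectorUnitary : Matrix ι ι ℂ) * (cfc f X - cfc f Y) *
        (hY.eigenvectorUnitary : Matrix ι ι ℂ) =
      Matrix.of (fun i k => (L (hX.eigenvalues i) (hY.eigenvalues k) : ℂ)) ⊙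
        (star (hX.eigenvectorUnitary : Matrix ι ι ℂ) * (X - Y) *
          (hY.eigenvectorUnitary : Matrix ι ι ℂ)) := by
  set UX : Matrix ι ι ℂ := (hX.eigenvectorUnitary : Matrix ι ι ℂ) with hUX
  set UY : Matrix ι ι ℂ := (hY.eigenvectorUnitary : Matrix ι ι ℂ) with hUY
  have hUXu : star UX * UX = 1 := Unitary.coe_star_mul_self hX.eigenvectorUnitary
  have hUYu : star UY * UY = 1 := Unitary.coe_star_mul_self hY.eigenvectorUnitary
  set W := star UX * UY with hW
  -- the four conjugated pieces
  have h1 : star UX * cfc f X * UY = Matrix.diagonal (RCLike.ofReal ∘ f ∘ hX.eigenvalues) * W := by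
    rw [hX.cfc_eq, Matrix.IsHermitian.cfc, Unitary.conjStarAlgAut_apply, ← hUX]
    rw [show star UX * (UX * Matrix.diagonal (RCLike.ofReal ∘ f ∘ hX.eigenvalues) * star UX) * UY =
      (star UX * UX) * Matrix.diagonal (RCLike.ofReal ∘ f ∘ hX.eigenvalues) * (star UX * UY) by
      simp only [Matrix.mul_assoc], hUXu, Matrix.one_mul]
  have h2 : star UX * cfc f Y * UY = W * Matrix.diagonal (RCLike.ofReal ∘ f ∘ hY.eigenvalues) := by
    rw [hY.cfc_eq, Matrix.IsHermitian.cfc, Unitary.conjStarAlgAut_apply, ← hUY]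
    rw [show star UX * (UY * Matrix.diagonal (RCLike.ofReal ∘ f ∘ hY.eigenvalues) * star UY) * UY =
      (star UX * UY) * Matrix.diagonal (RCLike.ofReal ∘ f ∘ hY.eigenvalues) * (star UY * UY) by
      simp only [Matrix.mul_assoc], hUYu, Matrix.mul_one]
  have h3 : star UX * X * UY = Matrix.diagonal (RCLike.ofReal ∘ hX.eigenvalues) * W := by
    conv_lhs => rw [hX.spectral_theorem, Unitary.conjStarAlgAut_apply, ← hUX]
    rw [show star UX * (UX * Matrix.diagonal (RCLike.ofReal ∘ hX.eigenvalues) * star UX) * UY =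
      (star UX * UX) * Matrix.diagonal (RCLike.ofReal ∘ hX.eigenvalues) * (star UX * UY) by
      simp only [Matrix.mul_assoc], hUXu, Matrix.one_mul]
  have h4 : star UX * Y * UY = W * Matrix.diagonal (RCLike.ofReal ∘ hY.eigenvalues) := by
    conv_lhs => rw [hY.spectral_theorem, Unitary.conjStarAlgAut_apply, ← hUY]
    rw [show star UX * (UY * Matrix.diagonal (RCLike.ofReal ∘ hY.eigenvalues) * star UY) * UY =
      (star UX * UY) * Matrix.diagonal (RCLike.ofReal ∘ hY.eigenvalues) * (star UY * UY) by
      simp only [Matrix.mul_assoc], hUYu, Matrix.mul_one]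
  rw [Matrix.mul_sub, Matrix.sub_mul, h1, h2, Matrix.mul_sub, Matrix.sub_mul, h3, h4]
  ext i k
  simp only [Matrix.sub_apply, Matrix.diagonal_mul, Matrix.mul_diagonal, Function.comp_apply,
    Matrix.hadamard_apply, Matrix.of_apply]
  have hc : ∀ r : ℝ, (RCLike.ofReal r : ℂ) = (r : ℂ) := fun r => rfl
  simp only [hc]
  have := hL (hX.eigenvalues i) (hY.eigenvalues k)
  have : (L (hX.eigenvalues i) (hY.eigenvalues k) : ℂ) *
      ((hX.eigenvalues i : ℂ) - (hY.eigenvalues k : ℂ)) =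
        (f (hX.eigenvalues i) : ℂ) - (f (hY.eigenvalues k) : ℂ) := by exact_mod_cast this
  linear_combination W i k * this.symm

/-- Entries of eigenvector unitaries have norm at most one. [folklore] -/
theorem norm_eigenvectorUnitary_apply_le {X : Matrix ι ι ℂ} (hX : X.IsHermitian) (i j : ι) :
    ‖(hX.eigenvectorUnitary : Matrix ι ι ℂ) i j‖ ≤ 1 :=
  entry_norm_bound_of_unitary hX.eigenvectorUnitary.2 i j

/-- Auxiliary for the proof of Loewner's theorem
(`norm_star_eigenvectorUnitary_apply_le`: norm star eigenvectorUnitary apply le). [folklore] -/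
theorem norm_star_eigenvectorUnitary_apply_le {X : Matrix ι ι ℂ} (hX : X.IsHermitian) (i j : ι) :
    ‖(star (hX.eigenvectorUnitary : Matrix ι ι ℂ)) i j‖ ≤ 1 := by
  rw [Matrix.star_apply, norm_star]
  exact norm_eigenvectorUnitary_apply_le hX j i

/-- **Crude Lipschitz bound for matrix functions**: if the slope function of `f` is bounded by
`M` on the spectra, then `entrySum (f(X) - f(Y)) ≤ n⁴ M · entrySum (X - Y)`. [folklore] -/
theorem entrySum_cfc_sub_cfc_le {X Y : Matrix ι ι ℂ} (hX : X.IsHermitian) (hY : Y.IsHermitian)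
    (f : ℝ → ℝ) {L : ℝ → ℝ → ℝ} (hL : ∀ a b, L a b * (a - b) = f a - f b) {M : ℝ} (hM0 : 0 ≤ M)
    (hM : ∀ i k, |L (hX.eigenvalues i) (hY.eigenvalues k)| ≤ M) :
    entrySum (cfc f X - cfc f Y) ≤ (Fintype.card ι : ℝ) ^ 4 * M * entrySum (X - Y) := by
  set UX : Matrix ι ι ℂ := (hX.eigenvectorUnitary : Matrix ι ι ℂ) with hUX
  set UY : Matrix ι ι ℂ := (hY.eigenvectorUnitary : Matrix ι ι ℂ) with hUY
  have hA := lemmaA hX hY f hL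
  -- undo the conjugation
  have hXu : UX * star UX = 1 := Unitary.coe_mul_star_self hX.eigenvectorUnitary
  have hYu : UY * star UY = 1 := Unitary.coe_mul_star_self hY.eigenvectorUnitary
  have hrepr : cfc f X - cfc f Y = UX * (star UX * (cfc f X - cfc f Y) * UY) * star UY := by
    rw [show UX * (star UX * (cfc f X - cfc f Y) * UY) * star UY =
      (UX * star UX) * (cfc f X - cfc f Y) * (UY * star UY) by simp only [Matrix.mul_assoc],
      hXu, hYu, Matrix.one_mul, Matrix.mul_one]
  rw [hrepr, hA]
  calc entrySum (UX * (Matrix.of (fun i k => (L (hX.eigenvalues i) (hY.eigenvalues k) : ℂ)) ⊙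
          (star UX * (X - Y) * UY)) * star UY)
      ≤ (Fintype.card ι : ℝ) ^ 2 * entrySum (Matrix.of
          (fun i k => (L (hX.eigenvalues i) (hY.eigenvalues k) : ℂ)) ⊙ (star UX * (X - Y) * UY)) :=
        entrySum_mul_mul_le (norm_eigenvectorUnitary_apply_le hX)
          (fun i j => by rw [Matrix.star_apply, norm_star]; exact norm_eigenvectorUnitary_apply_le hY j i) _
    _ ≤ (Fintype.card ι : ℝ) ^ 2 * (M * entrySum (star UX * (X - Y) * UY)) := by
        gcongr
        refine entrySum_hadamard_le (fun i k => ?_) _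
        rw [Matrix.of_apply, Complex.norm_real, Real.norm_eq_abs]
        exact hM i k
    _ ≤ (Fintype.card ι : ℝ) ^ 2 * (M * ((Fintype.card ι : ℝ) ^ 2 * entrySum (X - Y))) := by
        gcongr
        exact entrySum_mul_mul_le (norm_star_eigenvectorUnitary_apply_le hX)
          (norm_eigenvectorUnitary_apply_le hY) _
    _ = (Fintype.card ι : ℝ) ^ 4 * M * entrySum (X - Y) := by ring

end MatrixTools

end Literature.Analysis.Complex

namespace Literature.Analysis.Complex

open scoped ComplexOrder MatrixOrder Matrix.Norms.L2Operator
open Set Filter Topology Finset Polynomial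

section PolyExpansion

variable {ι : Type*} [Fintype ι] [DecidableEq ι]

/-! ### Expansion of `p(D + sH)` for a real polynomial `p` -/

omit [Fintype ι] [DecidableEq ι] in
/-- Real scalars act on complex matrices through `ℂ`. [folklore] -/
theorem real_smul_eq_coe_smul (c : ℝ) (M : Matrix ι ι ℂ) : c • M = (c : ℂ) • M :=
  (algebraMap_smul ℂ c M).symm

/-- **Expansion of a polynomial of `D + sH`.** [folklore] -/
theorem aeval_add_smul (D H : Matrix ι ι ℂ) (p : ℝ[X]) (s : ℝ) :
    aeval (D + (s : ℂ) • H) p = ∑ r ∈ range (p.natDegree + 1), ((s : ℂ) ^ r) • polyCoeff D H p r := by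
  rw [aeval_eq_sum_range]
  simp only [real_smul_eq_coe_smul, add_smul_pow_eq_sum, polyCoeff, Finset.smul_sum, smul_smul]
  -- extend the inner ranges to `natDegree + 1` and swap
  have hext : ∀ i ∈ range (p.natDegree + 1),
      ∑ r ∈ range (i + 1), ((p.coeff i : ℂ) * (s : ℂ) ^ r) • expandCoeff D H i r =
        ∑ r ∈ range (p.natDegree + 1), ((p.coeff i : ℂ) * (s : ℂ) ^ r) • expandCoeff D H i r := by
    intro i hi
    have hle : i + 1 ≤ p.natDegree + 1 := by have := Finset.mem_range.mp hi; omega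
    rw [← Finset.sum_range_add_sum_Ico _ hle, eq_comm, add_eq_left]
    refine Finset.sum_eq_zero fun r hr => ?_
    rw [expandCoeff_eq_zero D H (by have := (Finset.mem_Ico.mp hr).1; omega), smul_zero]
  rw [Finset.sum_congr rfl hext, Finset.sum_comm]
  refine Finset.sum_congr rfl fun r _ => Finset.sum_congr rfl fun i _ => ?_
  rw [mul_comm]

/-- The constant coefficient is `p(D)`. [folklore] -/
theorem polyCoeff_zero (D H : Matrix ι ι ℂ) (p : ℝ[X]) : polyCoeff D H p 0 = aeval D p := by
  rw [aeval_eq_sum_range, polyCoeff]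
  simp only [expandCoeff_zero_right, real_smul_eq_coe_smul]

/-- First-order coefficient for diagonal `D`: the Loewner matrix of `p` Hadamard `H`. [folklore] -/
theorem polyCoeff_one_apply (t : ι → ℝ) (H : Matrix ι ι ℂ) (p : ℝ[X]) (a b : ι) :
    polyCoeff (Matrix.diagonal fun i => ((t i : ℝ) : ℂ)) H p 1 a b =
      (polyDD1 p (t a) (t b) : ℂ) * H a b := by
  rw [polyDD1, p.sum_over_range (f := fun m c => c * pdd1 m (t a) (t b)) (fun n => zero_mul _)]
  simp only [polyCoeff, Matrix.sum_apply, Matrix.smul_apply, smul_eq_mul, expandCoeff_one_apply]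
  push_cast
  simp only [Finset.sum_mul, mul_assoc]

/-- Second-order coefficient for diagonal `D`. [folklore] -/
theorem polyCoeff_two_apply (t : ι → ℝ) (H : Matrix ι ι ℂ) (p : ℝ[X]) (a b : ι) :
    polyCoeff (Matrix.diagonal fun i => ((t i : ℝ) : ℂ)) H p 2 a b =
      ∑ c, (polyDD2 p (t a) (t c) (t b) : ℂ) * H a c * H c b := by
  have hsum : ∀ c : ι, polyDD2 p (t a) (t c) (t b) =
      ∑ m ∈ range (p.natDegree + 1), p.coeff m * pdd2 m (t a) (t c) (t b) := fun c =>
    p.sum_over_range (f := fun m co => co * pdd2 m (t a) (t c) (t b)) (fun n => zero_mul _)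
  simp only [hsum, polyCoeff, Matrix.sum_apply, Matrix.smul_apply, smul_eq_mul, expandCoeff_two_apply]
  push_cast
  simp only [Finset.mul_sum, Finset.sum_mul, mul_assoc]
  rw [Finset.sum_comm]

/-- **Daleckii–Krein for polynomials, first order:** the derivative of `u ↦ p(D + uH)` at `0` is
`polyCoeff D H p 1`. [folklore] -/
theorem hasDerivAt_aeval_add_smul (D H : Matrix ι ι ℂ) (p : ℝ[X]) :
    HasDerivAt (fun u : ℝ => aeval (D + (u : ℂ) • H) p) (polyCoeff D H p 1) 0 := by
  have hfun : (fun u : ℝ => aeval (D + (u : ℂ) • H) p) =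
      fun u : ℝ => ∑ r ∈ range (p.natDegree + 1), ((u : ℂ) ^ r) • polyCoeff D H p r := by
    funext u; exact aeval_add_smul D H p u
  rw [hfun]
  have hterm : ∀ r ∈ range (p.natDegree + 1), HasDerivAt (fun u : ℝ => ((u : ℂ) ^ r) • polyCoeff D H p r)
      ((((r : ℝ) * (0 : ℝ) ^ (r - 1) : ℝ) : ℂ) • polyCoeff D H p r) 0 := by
    intro r _
    have h1 : HasDerivAt (fun u : ℝ => u ^ r) ((r : ℝ) * (0 : ℝ) ^ (r - 1)) 0 := hasDerivAt_pow r 0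
    have h2 := h1.ofReal_comp
    simpa using h2.smul_const (polyCoeff D H p r)
  have hsum := HasDerivAt.fun_sum hterm
  have h1 : ∀ r ∈ range (p.natDegree + 1), r ≠ 1 →
      ((((r : ℝ) * (0 : ℝ) ^ (r - 1) : ℝ) : ℂ) • polyCoeff D H p r) = 0 := by
    intro r _ hr
    rcases Nat.lt_or_gt_of_ne hr with h | h
    · interval_cases r; simp
    · obtain ⟨k, rfl⟩ := Nat.exists_eq_add_of_lt h
      simp
  have h2 : 1 ∉ range (p.natDegree + 1) →
      ((((1 : ℕ) : ℝ) * (0 : ℝ) ^ (1 - 1) : ℝ) : ℂ) • polyCoeff D H p 1 = 0 := by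
    intro h
    have hdeg : p.natDegree = 0 := by simp only [Finset.mem_range] at h; omega
    have : polyCoeff D H p 1 = 0 := by
      rw [polyCoeff, hdeg]
      simp [expandCoeff_eq_zero]
    rw [this, smul_zero]
  have hval : (∑ i ∈ range (p.natDegree + 1), (((i : ℝ) * (0 : ℝ) ^ (i - 1) : ℝ) : ℂ) •
      polyCoeff D H p i) = polyCoeff D H p 1 := by
    rw [Finset.sum_eq_single 1 h1 h2]
    simp
  rw [hval] at hsum
  exact hsum

end PolyExpansion

end Literature.Analysis.Complex

namespace Literature.Analysis.Complex

open scoped ComplexOrder MatrixOrder Matrix.Norms.L2Operator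
open Set Filter Topology Finset Polynomial

section MoreTools

variable {ι : Type*} [Fintype ι] [DecidableEq ι]

/-! ### More on the expansion: conjugation, base point in the middle, second differences -/

/-- `pdd2 (m+1) x 0 y = pdd1 m x y`: the second divided difference of `t^{m+1}` with a zero
middle node is the first divided difference of `t^m`. [folklore] -/
theorem pdd2_succ_zero_mid (m : ℕ) (x y : ℝ) : pdd2 (m + 1) x 0 y = pdd1 m x y := by
  induction m with
  | zero => simp [pdd2_succ, pdd1]
  | succ m ih => rw [pdd2_succ, ih, pdd1_succ m x 0, mul_zero, zero_add, ← pdd1_succ]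

/-- Symmetry of `pdd2 m x 0 y` in `x ↔ y`. [folklore] -/
theorem pdd2_zero_mid_comm (m : ℕ) (x y : ℝ) : pdd2 m x 0 y = pdd2 m y 0 x := by
  rcases m with _ | m
  · simp
  · rw [pdd2_succ_zero_mid, pdd2_succ_zero_mid, pdd1_comm]

/-- Conjugating `D` and `H` by a unitary conjugates the expansion coefficients. [folklore] -/
theorem expandCoeff_conj {U : Matrix ι ι ℂ} (hU : star U * U = 1) (D H : Matrix ι ι ℂ) (m r : ℕ) :
    expandCoeff (U * D * star U) (U * H * star U) m r = U * expandCoeff D H m r * star U := by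
  induction m generalizing r with
  | zero =>
    rcases r with _ | r
    · simp only [expandCoeff_zero_zero, Matrix.mul_one]
      -- U * star U = 1 for a unitary matrix (finite dimension)
      exact (mul_eq_one_comm.mp hU).symm
    · simp
  | succ m ih =>
    have hUU : ∀ Z : Matrix ι ι ℂ, star U * (U * Z) = Z := fun Z => by
      rw [← Matrix.mul_assoc, hU, Matrix.one_mul]
    rcases r with _ | r
    · rw [expandCoeff_succ_zero, expandCoeff_succ_zero, ih]
      simp only [Matrix.mul_assoc, hUU]
    · rw [expandCoeff_succ_succ, expandCoeff_succ_succ, ih, ih]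
      simp only [Matrix.mul_assoc, Matrix.mul_add, Matrix.add_mul, hUU]

/-- Auxiliary for the proof of Loewner's theorem (`polyCoeff_conj`: polyCoeff conj). [folklore] -/
theorem polyCoeff_conj {U : Matrix ι ι ℂ} (hU : star U * U = 1) (D H : Matrix ι ι ℂ) (p : ℝ[X])
    (r : ℕ) : polyCoeff (U * D * star U) (U * H * star U) p r = U * polyCoeff D H p r * star U := by
  simp only [polyCoeff, expandCoeff_conj hU, Finset.mul_sum, Finset.sum_mul, Matrix.mul_smul,
    Matrix.smul_mul]

/-- **Second symmetric differences of a polynomial of matrices**: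
`s⁻² (p(D+sH) + p(D-sH) - 2 p(D)) → 2 • polyCoeff D H p 2` as `s → 0`. [folklore] -/
theorem tendsto_second_difference_aeval (D H : Matrix ι ι ℂ) (p : ℝ[X]) :
    Tendsto (fun s : ℝ => ((s : ℂ) ^ 2)⁻¹ •
        (aeval (D + (s : ℂ) • H) p + aeval (D + ((-s : ℝ) : ℂ) • H) p - (2 : ℂ) • aeval D p))
      (𝓝[≠] 0) (𝓝 ((2 : ℂ) • polyCoeff D H p 2)) := by
  -- coefficient functions
  set c : ℕ → ℝ → ℂ := fun r s => if r < 2 then 0 else (s : ℂ) ^ (r - 2) * (1 + (-1) ^ r) with hc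
  have hident : ∀ s : ℝ, s ≠ 0 →
      ((s : ℂ) ^ 2)⁻¹ • (aeval (D + (s : ℂ) • H) p + aeval (D + ((-s : ℝ) : ℂ) • H) p -
        (2 : ℂ) • aeval D p) = ∑ r ∈ range (p.natDegree + 1), c r s • polyCoeff D H p r := by
    intro s hs
    have hs' : (s : ℂ) ≠ 0 := Complex.ofReal_ne_zero.mpr hs
    rw [aeval_add_smul, aeval_add_smul, ← polyCoeff_zero D H p]
    -- 2 • pC 0 as the r = 0 terms
    have h0 : (2 : ℂ) • polyCoeff D H p 0 =
        ∑ r ∈ range (p.natDegree + 1), (if r = 0 then (2 : ℂ) else 0) • polyCoeff D H p r := by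
      rw [Finset.sum_eq_single 0 (fun r _ hr => by simp [hr]) (fun h => by simp at h)]
      simp
    rw [h0, ← Finset.sum_add_distrib, ← Finset.sum_sub_distrib, Finset.smul_sum]
    refine Finset.sum_congr rfl fun r _ => ?_
    rw [← add_smul, ← sub_smul, smul_smul]
    congr 1
    simp only [hc]
    push_cast
    rcases r with _ | _ | r
    · norm_num
    · simp
    · simp only [show ¬ (r + 1 + 1 < 2) from by omega, if_false, show r + 1 + 1 ≠ 0 from by omega,
        show r + 1 + 1 - 2 = r from by omega]
      rw [show r + 1 + 1 = r + 2 from by ring, pow_add, pow_add, neg_pow, pow_add]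
      field_simp
      ring
  have hlim : Tendsto (fun s : ℝ => ∑ r ∈ range (p.natDegree + 1), c r s • polyCoeff D H p r)
      (𝓝 0) (𝓝 ((2 : ℂ) • polyCoeff D H p 2)) := by
    have hval : (2 : ℂ) • polyCoeff D H p 2 =
        ∑ r ∈ range (p.natDegree + 1), c r 0 • polyCoeff D H p r := by
      by_cases h2 : 2 ∈ range (p.natDegree + 1)
      · rw [Finset.sum_eq_single_of_mem 2 h2]
        · simp [hc]; norm_num
        · intro r _ hr
          simp only [hc]
          rcases Nat.lt_or_gt_of_ne hr with h | h
          · simp [h]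
          · obtain ⟨k, rfl⟩ := Nat.exists_eq_add_of_lt h
            simp
      · -- degree < 2 : both sides vanish
        have hdeg : p.natDegree + 1 ≤ 2 := by simpa using h2
        have hz : polyCoeff D H p 2 = 0 := by
          apply Finset.sum_eq_zero
          intro m hm
          rw [expandCoeff_eq_zero D H (by have := Finset.mem_range.mp hm; omega), smul_zero]
        rw [hz, smul_zero]
        symm
        apply Finset.sum_eq_zero
        intro r hr
        have : r < 2 := by have := Finset.mem_range.mp hr; omega
        simp only [hc, if_pos this, zero_smul]
    rw [hval]
    refine tendsto_finsetSum _ fun r _ => Tendsto.smul_const ?_ _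
    simp only [hc]
    split_ifs
    · exact tendsto_const_nhds
    · exact ((Complex.continuous_ofReal.pow _).mul continuous_const).tendsto' _ _ (by simp)
  refine (hlim.mono_left nhdsWithin_le_nhds).congr' ?_
  filter_upwards [self_mem_nhdsWithin] with s hs
  exact (hident s hs).symm

/-! ### `cfc` of a real diagonal matrix, and Lemma A in column form -/

/-- `spectrum ℝ` of a complex diagonal matrix with real diagonal `t` is `range t`. [folklore] -/
theorem spectrum_real_diagonal (t : ι → ℝ) :
    spectrum ℝ (Matrix.diagonal fun i => ((t i : ℝ) : ℂ)) = Set.range t := by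
  ext x
  rw [← spectrum.preimage_algebraMap ℂ, Set.mem_preimage, spectrum_diagonal]
  constructor
  · rintro ⟨i, hi⟩
    refine ⟨i, ?_⟩
    have : ((t i : ℝ) : ℂ) = ((x : ℝ) : ℂ) := hi
    exact_mod_cast this
  · rintro ⟨i, rfl⟩
    exact ⟨i, rfl⟩

/-- Polynomials of diagonal matrices. [folklore] -/
theorem aeval_diagonal_real (t : ι → ℝ) (q : ℝ[X]) :
    aeval (Matrix.diagonal fun i => ((t i : ℝ) : ℂ)) q = Matrix.diagonal fun i => ((q.eval (t i) : ℝ) : ℂ) := by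
  rw [aeval_eq_sum_range]
  ext i j
  simp only [real_smul_eq_coe_smul, Matrix.diagonal_pow, Matrix.sum_apply, Matrix.smul_apply,
    Matrix.diagonal_apply, Pi.pow_apply, smul_eq_mul, mul_ite, mul_zero]
  by_cases hij : i = j
  · subst hij
    simp only [if_true, Polynomial.eval_eq_sum_range]
    push_cast
    rfl
  · simp [hij]

set_option maxHeartbeats 400000 in
/-- **`cfc` of a real diagonal matrix**: `f(diag t) = diag (f ∘ t)` for every `f`. [folklore] -/
theorem cfc_diagonal_real (f : ℝ → ℝ) (t : ι → ℝ) :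
    cfc f (Matrix.diagonal fun i => ((t i : ℝ) : ℂ)) = Matrix.diagonal fun i => ((f (t i) : ℝ) : ℂ) := by
  classical
  -- interpolate `f` on the finite set of nodes `range t`
  set nodes : Finset ℝ := Finset.univ.image t with hnodes
  set q : ℝ[X] := Lagrange.interpolate nodes id f with hq
  have hqf : ∀ i, q.eval (t i) = f (t i) := by
    intro i
    have hi : t i ∈ nodes := Finset.mem_image_of_mem t (Finset.mem_univ i)
    have := Lagrange.eval_interpolate_at_node (r := f) (Set.injOn_id _) hi
    simpa [hq] using this
  have hD : IsSelfAdjoint (Matrix.diagonal fun i => ((t i : ℝ) : ℂ)) := by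
    rw [← Matrix.isHermitian_iff_isSelfAdjoint]
    exact Matrix.isHermitian_diagonal_of_self_adjoint _ (funext fun i => by simp)
  have hcongr : (spectrum ℝ (Matrix.diagonal fun i => ((t i : ℝ) : ℂ))).EqOn f (fun x => q.eval x) := by
    rw [spectrum_real_diagonal]
    rintro _ ⟨i, rfl⟩
    exact (hqf i).symm
  rw [cfc_congr hcongr, cfc_polynomial q _ hD, aeval_diagonal_real]
  simp only [hqf]

/-- **Lemma A, column form** (no eigenvectors): for Hermitian `X`, a real diagonal `diag t` and a
slope function `L` of `f`,
`(f(X) - diag (f ∘ t))_{ab} = (L(X, t_b) · (X - diag t))_{ab}` where `L(X, t_b) = cfc (L · t_b) X`.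
[cite: RosenblumRovnyak1985, Ch. 2 Examples and Addenda no. 3 Lemma A] -/
theorem lemmaA_col {X : Matrix ι ι ℂ} (hX : X.IsHermitian) (t : ι → ℝ) (f : ℝ → ℝ)
    {L : ℝ → ℝ → ℝ} (hL : ∀ a b, L a b * (a - b) = f a - f b) (a b : ι) :
    (cfc f X - Matrix.diagonal fun i => ((f (t i) : ℝ) : ℂ)) a b =
      (cfc (fun x => L x (t b)) X * (X - Matrix.diagonal fun i => ((t i : ℝ) : ℂ))) a b := by
  have hX' : IsSelfAdjoint X := hX
  have hcont : ∀ g : ℝ → ℝ, ContinuousOn g (spectrum ℝ X) := fun g =>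
    (Matrix.finite_real_spectrum (A := X)).continuousOn g
  -- `cfc (L · t_b) X * (X - t_b) = cfc f X - f(t_b)`
  have hkey : cfc (fun x => L x (t b)) X * (X - algebraMap ℝ _ (t b)) =
      cfc f X - algebraMap ℝ _ (f (t b)) := by
    have h1 : X - algebraMap ℝ _ (t b) = cfc (fun x => x - t b) X := by
      rw [cfc_sub _ _ X (hcont _) (hcont _), cfc_id' ℝ X, cfc_const (t b) X]
    rw [h1, ← cfc_mul _ _ X (hcont _) (hcont _)]
    have h2 : cfc f X - algebraMap ℝ _ (f (t b)) = cfc (fun x => f x - f (t b)) X := by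
      rw [cfc_sub _ _ X (hcont _) (hcont _), cfc_const (f (t b)) X]
    rw [h2]
    exact cfc_congr fun x _ => hL x (t b)
  -- compare entries
  have hR : (cfc (fun x => L x (t b)) X * (X - Matrix.diagonal fun i => ((t i : ℝ) : ℂ))) a b =
      (cfc (fun x => L x (t b)) X * (X - algebraMap ℝ _ (t b))) a b := by
    simp only [Matrix.mul_apply, Matrix.sub_apply, Matrix.algebraMap_matrix_apply,
      Matrix.diagonal_apply]
    refine Finset.sum_congr rfl fun c _ => ?_
    by_cases hcb : c = b
    · subst hcb; simp
    · simp [hcb]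
  rw [hR, hkey]
  simp only [Matrix.sub_apply, Matrix.algebraMap_matrix_apply, Matrix.diagonal_apply]
  by_cases hab : a = b
  · subst hab; simp
  · simp [hab]

/-! ### Products and the entrywise size -/

omit [DecidableEq ι] in
/-- Auxiliary for the proof of Loewner's theorem (`entrySum_mul_le`: entrySum mul le). [folklore] -/
theorem entrySum_mul_le (A B : Matrix ι ι ℂ) : entrySum (A * B) ≤ entrySum A * entrySum B := by
  unfold entrySum
  calc ∑ a, ∑ b, ‖(A * B) a b‖ ≤ ∑ a, ∑ b, ∑ c, ‖A a c‖ * ‖B c b‖ := by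
        refine Finset.sum_le_sum fun a _ => Finset.sum_le_sum fun b _ => ?_
        rw [Matrix.mul_apply]
        exact (norm_sum_le _ _).trans (le_of_eq (Finset.sum_congr rfl fun c _ => norm_mul _ _))
    _ = ∑ a, ∑ c, ‖A a c‖ * ∑ b, ‖B c b‖ := by
        refine Finset.sum_congr rfl fun a _ => ?_
        rw [Finset.sum_comm]
        exact Finset.sum_congr rfl fun c _ => by rw [Finset.mul_sum]
    _ ≤ ∑ a, ∑ c, ‖A a c‖ * ∑ c', ∑ b, ‖B c' b‖ := by
        refine Finset.sum_le_sum fun a _ => Finset.sum_le_sum fun c _ => ?_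
        refine mul_le_mul_of_nonneg_left ?_ (norm_nonneg _)
        exact Finset.single_le_sum (f := fun c' => ∑ b, ‖B c' b‖)
          (fun _ _ => Finset.sum_nonneg fun _ _ => norm_nonneg _) (Finset.mem_univ c)
    _ = (∑ a, ∑ c, ‖A a c‖) * ∑ c', ∑ b, ‖B c' b‖ := by
        rw [Finset.sum_mul]; exact Finset.sum_congr rfl fun a _ => by rw [Finset.sum_mul]

end MoreTools

end Literature.Analysis.Complex

namespace Literature.Analysis.Complex

open scoped ComplexOrder MatrixOrder Matrix.Norms.L2Operator
open Set Filter Topology Finset Polynomial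

/-! ### Interpolation on finite sets; `cfc` versus polynomials and reindexing -/

section Transport

/-- On a finite set every real function agrees with a polynomial. [folklore] -/
theorem exists_polynomial_eqOn_of_finite {S : Set ℝ} (hS : S.Finite) (f : ℝ → ℝ) :
    ∃ q : ℝ[X], S.EqOn f fun x => q.eval x := by
  classical
  refine ⟨Lagrange.interpolate hS.toFinset id f, fun x hx => ?_⟩
  have hx' : x ∈ hS.toFinset := hS.mem_toFinset.mpr hx
  have := Lagrange.eval_interpolate_at_node (r := f) (Set.injOn_id _) hx'
  simpa using this.symm

variable {ι ι' : Type*} [Fintype ι] [DecidableEq ι] [Fintype ι'] [DecidableEq ι']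

/-- `cfc` of a Hermitian matrix is a polynomial in the matrix. [folklore] -/
theorem exists_cfc_eq_aeval {A : Matrix ι ι ℂ} (hA : A.IsHermitian) (f : ℝ → ℝ) :
    ∃ q : ℝ[X], (spectrum ℝ A).EqOn f (fun x => q.eval x) ∧ cfc f A = aeval A q := by
  obtain ⟨q, hq⟩ := exists_polynomial_eqOn_of_finite (Matrix.finite_real_spectrum (A := A)) f
  exact ⟨q, hq, by rw [cfc_congr hq, cfc_polynomial q A (show IsSelfAdjoint A from hA)]⟩

/-- `cfc` commutes with reindexing. [folklore] -/
theorem cfc_reindex' (e : ι ≃ ι') (f : ℝ → ℝ) {A : Matrix ι ι ℂ} (hA : A.IsHermitian) :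
    cfc f (Matrix.reindex e e A) = Matrix.reindex e e (cfc f A) := by
  have hA' : (Matrix.reindex e e A).IsHermitian := by
    unfold Matrix.IsHermitian
    rw [Matrix.conjTranspose_reindex, hA]
  obtain ⟨q, hq, hqA⟩ := exists_cfc_eq_aeval hA f
  have hspec : spectrum ℝ (Matrix.reindex e e A) = spectrum ℝ A := by
    rw [← Matrix.coe_reindexAlgEquiv ℝ ℂ e, AlgEquiv.spectrum_eq]
  have hq' : (spectrum ℝ (Matrix.reindex e e A)).EqOn f fun x => q.eval x := hspec ▸ hq
  rw [cfc_congr hq', cfc_polynomial q _ (show IsSelfAdjoint _ from hA'), hqA,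
    ← Matrix.coe_reindexAlgEquiv ℝ ℂ e, Polynomial.aeval_algEquiv]
  rfl

/-- **Matrix monotonicity is independent of the index type.** [folklore] -/
theorem IsMatrixMonotoneOn.posSemidef_of_fintype {f : ℝ → ℝ} {Δ : Set ℝ}
    (h : IsMatrixMonotoneOn f Δ) {A B : Matrix ι ι ℂ} (hA : A.IsHermitian) (hB : B.IsHermitian)
    (hAs : spectrum ℝ A ⊆ Δ) (hBs : spectrum ℝ B ⊆ Δ) (hAB : (B - A).PosSemidef) :
    (cfc f B - cfc f A).PosSemidef := by
  set e := Fintype.equivFin ι with he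
  have hre : ∀ M : Matrix ι ι ℂ, M.IsHermitian → (Matrix.reindex e e M).IsHermitian := fun M hM => by
    unfold Matrix.IsHermitian; rw [Matrix.conjTranspose_reindex, hM]
  have hsp : ∀ M : Matrix ι ι ℂ, spectrum ℝ (Matrix.reindex e e M) = spectrum ℝ M := fun M => by
    rw [← Matrix.coe_reindexAlgEquiv ℝ ℂ e, AlgEquiv.spectrum_eq]
  have hsub : ∀ M N : Matrix ι ι ℂ, Matrix.reindex e e M - Matrix.reindex e e N =
      Matrix.reindex e e (M - N) := fun M N => rfl
  have key := h (Fintype.card ι) (Matrix.reindex e e A) (Matrix.reindex e e B) (hre A hA) (hre B hB)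
    ((hsp A).symm ▸ hAs) ((hsp B).symm ▸ hBs) (by
      rw [hsub, Matrix.reindex_apply]
      exact (Matrix.posSemidef_submatrix_equiv e.symm).mpr hAB)
  rw [cfc_reindex' e f hB, cfc_reindex' e f hA, hsub, Matrix.reindex_apply] at key
  exact (Matrix.posSemidef_submatrix_equiv e.symm).mp key

end Transport

/-! ### Elementary closure properties of matrix monotonicity -/

section MonotoneAPI

variable {f g : ℝ → ℝ} {Δ Δ' : Set ℝ}

/-- Auxiliary for the proof of Loewner's theorem (`IsMatrixMonotoneOn.mono`: mono). [folklore] -/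
theorem IsMatrixMonotoneOn.mono (h : IsMatrixMonotoneOn f Δ) (hΔ : Δ' ⊆ Δ) :
    IsMatrixMonotoneOn f Δ' := fun n A B hA hB hAs hBs hAB =>
  h n A B hA hB (hAs.trans hΔ) (hBs.trans hΔ) hAB

/-- Auxiliary for the proof of Loewner's theorem (`IsMatrixMonotoneOn.congr`: congr). [folklore] -/
theorem IsMatrixMonotoneOn.congr (h : IsMatrixMonotoneOn f Δ) (hfg : Δ.EqOn f g) :
    IsMatrixMonotoneOn g Δ := by
  intro n A B hA hB hAs hBs hAB
  rw [← cfc_congr fun x hx => hfg (hAs hx), ← cfc_congr fun x hx => hfg (hBs hx)]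
  exact h n A B hA hB hAs hBs hAB

/-- Positive combinations of matrix monotone functions, plus a constant. [folklore] -/
theorem IsMatrixMonotoneOn.add_smul_const (hf : IsMatrixMonotoneOn f Δ)
    (hg : IsMatrixMonotoneOn g Δ) {a b : ℝ} (ha : 0 ≤ a) (hb : 0 ≤ b) (κ : ℝ) :
    IsMatrixMonotoneOn (fun x => κ + a * f x + b * g x) Δ := by
  intro n A B hA hB hAs hBs hAB
  have hA' : IsSelfAdjoint A := hA
  have hB' : IsSelfAdjoint B := hB
  have hc : ∀ (φ : ℝ → ℝ) (E : Matrix (Fin n) (Fin n) ℂ), ContinuousOn φ (spectrum ℝ E) :=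
    fun φ E => (Matrix.finite_real_spectrum (A := E)).continuousOn φ
  have hexp : ∀ (E : Matrix (Fin n) (Fin n) ℂ), IsSelfAdjoint E →
      cfc (fun x => κ + a * f x + b * g x) E =
        algebraMap ℝ _ κ + a • cfc f E + b • cfc g E := by
    intro E hE
    rw [cfc_add E _ _ (hc _ E) (hc _ E), cfc_add E _ _ (hc _ E) (hc _ E), cfc_const κ E,
      cfc_const_mul a f E (hc _ E), cfc_const_mul b g E (hc _ E)]
  rw [hexp A hA', hexp B hB']
  have h1 := hf n A B hA hB hAs hBs hAB
  have h2 := hg n A B hA hB hAs hBs hAB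
  have : algebraMap ℝ (Matrix (Fin n) (Fin n) ℂ) κ + a • cfc f B + b • cfc g B -
      (algebraMap ℝ (Matrix (Fin n) (Fin n) ℂ) κ + a • cfc f A + b • cfc g A) =
      a • (cfc f B - cfc f A) + b • (cfc g B - cfc g A) := by
    simp only [smul_sub]; abel
  rw [this]
  exact (h1.smul ha).add (h2.smul hb)

/-- The identity is matrix monotone. [folklore] -/
theorem isMatrixMonotoneOn_id (Δ : Set ℝ) : IsMatrixMonotoneOn (fun x => x) Δ := by
  intro n A B hA hB _ _ hAB
  rwa [cfc_id' ℝ B (show IsSelfAdjoint B from hB), cfc_id' ℝ A (show IsSelfAdjoint A from hA)]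

/-- Constants are matrix monotone. [folklore] -/
theorem isMatrixMonotoneOn_const (κ : ℝ) (Δ : Set ℝ) : IsMatrixMonotoneOn (fun _ => κ) Δ := by
  intro n A B hA hB _ _ _
  rw [cfc_const κ B (show IsSelfAdjoint B from hB), cfc_const κ A (show IsSelfAdjoint A from hA),
    sub_self]
  exact Matrix.PosSemidef.zero

/-- **Affine change of variable**: if `f` is matrix monotone on `Δ` and `a > 0` then
`x ↦ f (a x + b)` is matrix monotone on the preimage of `Δ`. [folklore] -/
theorem IsMatrixMonotoneOn.comp_affine (h : IsMatrixMonotoneOn f Δ) {a b : ℝ} (ha : 0 < a) :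
    IsMatrixMonotoneOn (fun x => f (a * x + b)) ((fun x => a * x + b) ⁻¹' Δ) := by
  intro n A B hA hB hAs hBs hAB
  have hA' : IsSelfAdjoint A := hA
  have hB' : IsSelfAdjoint B := hB
  have hc : ∀ (φ : ℝ → ℝ) (S : Set ℝ), S.Finite → ContinuousOn φ S := fun φ S hS => hS.continuousOn φ
  -- the transformed matrices
  have htr : ∀ (E : Matrix (Fin n) (Fin n) ℂ), IsSelfAdjoint E → spectrum ℝ E ⊆ (fun x => a * x + b) ⁻¹' Δ →
      cfc (fun x => f (a * x + b)) E = cfc f (cfc (fun x => a * x + b) E) ∧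
        (cfc (fun x => a * x + b) E).IsHermitian ∧ spectrum ℝ (cfc (fun x => a * x + b) E) ⊆ Δ ∧
        cfc (fun x => a * x + b) E = a • E + algebraMap ℝ _ b := by
    intro E hE hEs
    refine ⟨?_, ?_, ?_, ?_⟩
    · rw [cfc_comp' f (fun x => a * x + b) E
        (hc _ _ ((Matrix.finite_real_spectrum (A := E)).image _))
        (hc _ _ (Matrix.finite_real_spectrum (A := E)))]
    · exact (cfc_predicate (fun x => a * x + b) E : IsSelfAdjoint _)
    · rw [cfc_map_spectrum (f := fun x => a * x + b) (a := E) hE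
        (hc _ _ (Matrix.finite_real_spectrum (A := E)))]
      rintro _ ⟨x, hx, rfl⟩
      exact hEs hx
    · rw [cfc_add E _ _ (hc _ _ (Matrix.finite_real_spectrum (A := E)))
        (hc _ _ (Matrix.finite_real_spectrum (A := E))), cfc_const_mul_id a E, cfc_const b E]
  obtain ⟨eA, hA2, hA3, hA4⟩ := htr A hA' hAs
  obtain ⟨eB, hB2, hB3, hB4⟩ := htr B hB' hBs
  rw [eA, eB]
  refine h n _ _ hA2 hB2 hA3 hB3 ?_
  rw [hA4, hB4, show a • B + algebraMap ℝ (Matrix (Fin n) (Fin n) ℂ) b -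
    (a • A + algebraMap ℝ (Matrix (Fin n) (Fin n) ℂ) b) = a • (B - A) by rw [smul_sub]; abel]
  exact hAB.smul ha.le

/-- **Reflection**: if `f` is matrix monotone on `Δ` then `x ↦ -f(-x)` is matrix monotone on `-Δ`.
[folklore] -/
theorem IsMatrixMonotoneOn.neg_comp_neg (h : IsMatrixMonotoneOn f Δ) :
    IsMatrixMonotoneOn (fun x => -f (-x)) ((fun x => -x) ⁻¹' Δ) := by
  intro n A B hA hB hAs hBs hAB
  have hA' : IsSelfAdjoint A := hA
  have hB' : IsSelfAdjoint B := hB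
  have hc : ∀ (φ : ℝ → ℝ) (S : Set ℝ), S.Finite → ContinuousOn φ S := fun φ S hS => hS.continuousOn φ
  have htr : ∀ (E : Matrix (Fin n) (Fin n) ℂ), IsSelfAdjoint E → spectrum ℝ E ⊆ (fun x => -x) ⁻¹' Δ →
      cfc (fun x => -f (-x)) E = -cfc f (-E) ∧ (-E).IsHermitian ∧ spectrum ℝ (-E) ⊆ Δ := by
    intro E hE hEs
    have hneg : cfc (fun x : ℝ => -x) E = -E := cfc_neg_id E hE
    refine ⟨?_, ?_, ?_⟩
    · rw [cfc_neg, cfc_comp' f (fun x => -x) E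
        (hc _ _ ((Matrix.finite_real_spectrum (A := E)).image _))
        (hc _ _ (Matrix.finite_real_spectrum (A := E))), hneg]
    · rw [← hneg]; exact (cfc_predicate (fun x : ℝ => -x) E : IsSelfAdjoint _)
    · rw [← hneg, cfc_map_spectrum (f := fun x : ℝ => -x) (a := E) hE
        (hc _ _ (Matrix.finite_real_spectrum (A := E)))]
      rintro _ ⟨x, hx, rfl⟩
      exact hEs hx
  obtain ⟨eA, hA2, hA3⟩ := htr A hA' hAs
  obtain ⟨eB, hB2, hB3⟩ := htr B hB' hBs
  rw [eA, eB, show -cfc f (-B) - -cfc f (-A) = cfc f (-A) - cfc f (-B) by abel]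
  refine h n _ _ hB2 hA2 hB3 hA3 ?_
  rw [show -A - -B = B - A by abel]
  exact hAB

/-- Matrix monotonicity is closed under pointwise limits along any filter. [folklore] -/
theorem IsMatrixMonotoneOn.of_tendsto {α : Type*} {l : Filter α} [l.NeBot] {F : α → ℝ → ℝ}
    (hF : ∀ᶠ k in l, IsMatrixMonotoneOn (F k) Δ)
    (hlim : ∀ x ∈ Δ, Tendsto (fun k => F k x) l (𝓝 (f x))) : IsMatrixMonotoneOn f Δ := by
  intro n A B hA hB hAs hBs hAB
  rw [← Matrix.le_iff, cfc_le_cfc_iff hA hB]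
  intro v
  have h1 : Tendsto (fun k => ∑ i, F k (hA.eigenvalues i) *
      Complex.normSq ((star (hA.eigenvectorUnitary : Matrix (Fin n) (Fin n) ℂ) *ᵥ v) i)) l
      (𝓝 (∑ i, f (hA.eigenvalues i) *
        Complex.normSq ((star (hA.eigenvectorUnitary : Matrix (Fin n) (Fin n) ℂ) *ᵥ v) i))) :=
    tendsto_finsetSum _ fun i _ => (hlim _ (hAs (hA.eigenvalues_mem_spectrum_real i))).mul_const _
  have h2 : Tendsto (fun k => ∑ i, F k (hB.eigenvalues i) *
      Complex.normSq ((star (hB.eigenvectorUnitary : Matrix (Fin n) (Fin n) ℂ) *ᵥ v) i)) l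
      (𝓝 (∑ i, f (hB.eigenvalues i) *
        Complex.normSq ((star (hB.eigenvectorUnitary : Matrix (Fin n) (Fin n) ℂ) *ᵥ v) i))) :=
    tendsto_finsetSum _ fun i _ => (hlim _ (hBs (hB.eigenvalues_mem_spectrum_real i))).mul_const _
  refine le_of_tendsto_of_tendsto h1 h2 ?_
  filter_upwards [hF] with k hk
  exact (cfc_le_cfc_iff hA hB (F k)).mp (Matrix.le_iff.mpr (hk n A B hA hB hAs hBs hAB)) v

end MonotoneAPI

end Literature.Analysis.Complex

namespace Literature.Analysis.Complex

open scoped ComplexOrder MatrixOrder Matrix.Norms.L2Operator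
open Set Filter Topology Finset Polynomial

/-! ### `C¹`/`C²` Weierstrass approximation on a compact interval -/

section Weierstrass

/-- Auxiliary for the proof of Loewner's theorem
(`derivative_antideriv`: derivative antideriv). [folklore] -/
theorem derivative_antideriv (p : ℝ[X]) : derivative (antideriv p) = p := by
  conv_rhs => rw [p.as_sum_range_C_mul_X_pow]
  simp only [antideriv, derivative_sum, derivative_C_mul_X_pow]
  refine Finset.sum_congr rfl fun k _ => ?_
  rw [Nat.add_sub_cancel]
  congr 2
  push_cast
  field_simp

/-- Auxiliary for the proof of Loewner's theorem
(`hasDerivAt_antideriv`: hasDerivAt antideriv). [folklore] -/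
theorem hasDerivAt_antideriv (p : ℝ[X]) (x : ℝ) :
    HasDerivAt (fun x => (antideriv p).eval x) (p.eval x) x := by
  have := (antideriv p).hasDerivAt x
  rwa [derivative_antideriv] at this

/-- One integration step: from a uniform approximation of `g'` by a polynomial to a `C¹`
approximation of `g`. [folklore] -/
theorem exists_polynomial_C1_of_C0 {g g' : ℝ → ℝ} {c d : ℝ} (hcd : c ≤ d)
    (hg : ∀ t ∈ Set.Icc c d, HasDerivAt g (g' t) t) {q : ℝ[X]} {ε : ℝ}
    (hq : ∀ x ∈ Set.Icc c d, |q.eval x - g' x| ≤ ε) :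
    ∃ P : ℝ[X], derivative P = q ∧ ∀ x ∈ Set.Icc c d, |P.eval x - g x| ≤ ε * (d - c) := by
  refine ⟨C (g c - (antideriv q).eval c) + antideriv q, by simp [derivative_antideriv], ?_⟩
  intro x hx
  -- h := P - g vanishes at c and has derivative q - g' bounded by ε
  have hderiv : ∀ t ∈ Set.Icc c d, HasDerivWithinAt
      (fun t => (C (g c - (antideriv q).eval c) + antideriv q).eval t - g t)
      (q.eval t - g' t) (Set.Icc c d) t := by
    intro t ht
    have h1 : HasDerivAt (fun t => (C (g c - (antideriv q).eval c) + antideriv q).eval t)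
        (q.eval t) t := by
      simp only [eval_add, eval_C]
      exact (hasDerivAt_antideriv q t).const_add _
    exact (h1.sub (hg t ht)).hasDerivWithinAt
  have key := Convex.norm_image_sub_le_of_norm_hasDerivWithin_le hderiv
    (fun t ht => by simpa [Real.norm_eq_abs] using hq t ht) (convex_Icc c d)
    (Set.left_mem_Icc.mpr hcd) hx
  have hPc : (C (g c - (antideriv q).eval c) + antideriv q).eval c - g c = 0 := by simp
  rw [hPc, sub_zero, Real.norm_eq_abs, Real.norm_eq_abs] at key
  have hxc : |x - c| ≤ d - c := by rw [abs_of_nonneg (by linarith [hx.1])]; linarith [hx.2]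
  have hε : 0 ≤ ε := le_trans (abs_nonneg _) (hq c (Set.left_mem_Icc.mpr hcd))
  calc |(C (g c - (antideriv q).eval c) + antideriv q).eval x - g x| ≤ ε * |x - c| := key
    _ ≤ ε * (d - c) := by gcongr

/-- **`C²` Weierstrass approximation**: a `C²` function on `[c, d]` is approximated by
polynomials together with its first two derivatives. [folklore] -/
theorem exists_polynomial_C2_near {g g' g'' : ℝ → ℝ} {c d : ℝ} (hcd : c ≤ d)
    (hg : ∀ t ∈ Set.Icc c d, HasDerivAt g (g' t) t)
    (hg' : ∀ t ∈ Set.Icc c d, HasDerivAt g' (g'' t) t)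
    (hg'' : ContinuousOn g'' (Set.Icc c d)) {ε : ℝ} (hε : 0 < ε) :
    ∃ P : ℝ[X], ∀ x ∈ Set.Icc c d, |P.eval x - g x| ≤ ε ∧ |P.derivative.eval x - g' x| ≤ ε ∧
      |P.derivative.derivative.eval x - g'' x| ≤ ε := by
  -- normalise so that all three errors are `≤ ε`
  set K : ℝ := max 1 (max (d - c) ((d - c) ^ 2)) with hK
  have hK1 : 1 ≤ K := le_max_left _ _
  have hK0 : 0 < K := by linarith
  obtain ⟨q, hq⟩ := exists_polynomial_near_of_continuousOn c d g'' hg'' (ε / K) (by positivity)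
  have hq' : ∀ x ∈ Set.Icc c d, |q.eval x - g'' x| ≤ ε / K := fun x hx => (hq x hx).le
  obtain ⟨P₁, hP₁d, hP₁⟩ := exists_polynomial_C1_of_C0 hcd hg' hq'
  obtain ⟨P, hPd, hP⟩ := exists_polynomial_C1_of_C0 hcd hg hP₁
  refine ⟨P, fun x hx => ⟨?_, ?_, ?_⟩⟩
  · calc |P.eval x - g x| ≤ ε / K * (d - c) * (d - c) := hP x hx
      _ = ε * ((d - c) ^ 2 / K) := by ring
      _ ≤ ε * 1 := by
          gcongr
          rw [div_le_one hK0]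
          exact (le_max_right _ _).trans (le_max_right _ _)
      _ = ε := mul_one ε
  · rw [hPd]
    calc |P₁.eval x - g' x| ≤ ε / K * (d - c) := hP₁ x hx
      _ = ε * ((d - c) / K) := by ring
      _ ≤ ε * 1 := by
          gcongr
          rw [div_le_one hK0]
          exact (le_max_left _ _).trans (le_max_right _ _)
      _ = ε := mul_one ε
  · rw [hPd, hP₁d]
    calc |q.eval x - g'' x| ≤ ε / K := hq' x hx
      _ ≤ ε / 1 := by gcongr
      _ = ε := div_one ε

end Weierstrass

/-! ### Quadratic forms and positivity -/

section QuadForm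

variable {ι : Type*} [Fintype ι]

/-- `|qform E w| ≤ entrySum E · ∑ |w_a|²`. [folklore] -/
theorem neg_le_qform (E : Matrix ι ι ℂ) (w : ι → ℂ) :
    -(entrySum E * ∑ a, ‖w a‖ ^ 2) ≤ qform E w := re_star_dotProduct_mulVec_ge E w

/-- Auxiliary for the proof of Loewner's theorem (`qform_le`: qform le). [folklore] -/
theorem qform_le (E : Matrix ι ι ℂ) (w : ι → ℂ) : qform E w ≤ entrySum E * ∑ a, ‖w a‖ ^ 2 := by
  have := re_star_dotProduct_mulVec_ge (-E) w
  rw [entrySum_neg] at this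
  simp only [qform, Matrix.neg_mulVec, dotProduct_neg, Complex.neg_re] at this ⊢
  linarith

/-- Auxiliary for the proof of Loewner's theorem
(`continuous_qform`: continuous qform). [folklore] -/
theorem continuous_qform (w : ι → ℂ) : Continuous fun M : Matrix ι ι ℂ => qform M w := by
  unfold qform
  refine Complex.continuous_re.comp ?_
  simp only [dotProduct, Matrix.mulVec]
  fun_prop

/-- Positivity through the real quadratic form (for Hermitian matrices). [folklore] -/
theorem posSemidef_iff_qform {M : Matrix ι ι ℂ} (hM : M.IsHermitian) :
    M.PosSemidef ↔ ∀ w, 0 ≤ qform M w := by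
  constructor
  · intro h w
    have := h.dotProduct_mulVec_nonneg w
    exact (Complex.nonneg_iff.mp this).1
  · intro h
    refine Matrix.PosSemidef.of_dotProduct_mulVec_nonneg hM fun w => ?_
    have hreal : (star w ⬝ᵥ (M *ᵥ w)).im = 0 := by
      -- the form is self-conjugate
      have hsa : star (star w ⬝ᵥ (M *ᵥ w)) = star w ⬝ᵥ (M *ᵥ w) := by
        conv_rhs => rw [Matrix.star_dotProduct, Matrix.star_mulVec, hM.eq,
          ← Matrix.dotProduct_mulVec]
      have := congrArg Complex.im hsa
      simp only [Complex.star_def, Complex.conj_im] at this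
      linarith
    exact Complex.nonneg_iff.mpr ⟨h w, hreal.symm⟩

/-- Auxiliary for the proof of Loewner's theorem
(`qform_nonneg_of_posSemidef`: qform nonneg of posSemidef). [folklore] -/
theorem qform_nonneg_of_posSemidef {M : Matrix ι ι ℂ} (hM : M.PosSemidef) (w : ι → ℂ) :
    0 ≤ qform M w := (posSemidef_iff_qform hM.1).mp hM w

end QuadForm

/-! ### Spectra and Löwner-order bounds -/

section SpecBounds

variable {ι : Type*} [Fintype ι] [DecidableEq ι]

/-- If `a•1 ≤ M ≤ b•1` then `spectrum ℝ M ⊆ [a, b]`. [folklore] -/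
theorem spectrum_subset_Icc_of_le_of_le {M : Matrix ι ι ℂ} (hM : M.IsHermitian) {a b : ℝ}
    (ha : (M - algebraMap ℝ _ a).PosSemidef) (hb : (algebraMap ℝ _ b - M).PosSemidef) :
    spectrum ℝ M ⊆ Icc a b := by
  have hM' : IsSelfAdjoint M := hM
  intro x hx
  constructor
  · exact (algebraMap_le_iff_le_spectrum (a := M) hM').mp (Matrix.le_iff.mpr ha) x hx
  · exact (le_algebraMap_iff_spectrum_le (a := M) hM').mp (Matrix.le_iff.mpr hb) x hx

/-- Conversely `spectrum ℝ M ⊆ [a, b]` gives `a•1 ≤ M ≤ b•1`. [folklore] -/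
theorem le_and_le_of_spectrum_subset {M : Matrix ι ι ℂ} (hM : M.IsHermitian) {a b : ℝ}
    (h : spectrum ℝ M ⊆ Icc a b) :
    (M - algebraMap ℝ _ a).PosSemidef ∧ (algebraMap ℝ _ b - M).PosSemidef := by
  have hM' : IsSelfAdjoint M := hM
  exact ⟨Matrix.le_iff.mp ((algebraMap_le_iff_le_spectrum (a := M) hM').mpr fun x hx => (h hx).1),
    Matrix.le_iff.mp ((le_algebraMap_iff_spectrum_le (a := M) hM').mpr fun x hx => (h hx).2)⟩

end SpecBounds

end Literature.Analysis.Complex
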